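import Literature.AlgebraicGeometry.AbelianSchemes.PDivisibleGroupBaseChangeIso              -- ★ p846589 `exists_iso_baseChange_pDivisibleGroup`, `baseChange_{ringAction,homOfCompatibleFamily}_app_comp`, `hrank_blockBTGroup_baseChange`
import Literature.AlgebraicGeometry.GroupSchemes.BarsottiTateGroupFixedPartBaseChangeAction -- ★ `fixBTGroupBaseChangeIso{,_hom_app_comp_fixLayerι}`, `baseChange_fixRestrict_comp_iso`, `fixRestrict`
import Literature.AlgebraicGeometry.GroupSchemes.BTGroupBlock                               -- ★ p846461 `IsRingActionBT.app_comp_homOfCompatibleFamily_app`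
import HarnessLib

/-!
# THE `w`-BLOCK ITSELF COMMUTES WITH BASE CHANGE: `(A[w^∞]) ×_S S′ ≅ (A ×_S S′)[w^∞]` inside `A ×_S S′`, `O`-equivariantly
# ([Tate 1967] §2 (2.1)–(2.2); [Messing 1972] Ch. I (1.1)–(1.6); [Rapoport–Smithling–Zhang 2020] §4.1 «(dec pdiv)»)

Topic `Literature/AlgebraicGeometry/AbelianSchemes`; namespaces `Literature.AlgebraicGeometry.GroupSchemes.BTGroup.Hom` (§1, generic Barsotti–Tate groups)
and `Literature.AlgebraicGeometry.AbelianSchemes.AbelianSchemeOver` (§2).  THEOREMS ONLY; no definition, no named fact, no instance, no notation, no `sorry`.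
Cell `hodgecm-mathlib` (D-0151), FLOOR 0, P6 «MOD programme» (crux hLiu418 = stmt-HodgeConjecture-24832), K∕BT desk F0P6d-plan (g2), DEAL 10 «(BC-w) THE
`w`-BLOCK ITSELF COMMUTES WITH BASE CHANGE» (2026-09-01T19:50Z); consumers: P6a ED3-CENSUS «`𝒢 := Fix(ε_w)` with its `𝓞_{F,w}`-action, read at the three
levels `Spec κ̄ ∕ Spec 𝒪_Ω ∕ Spec Ω` as ONE Barsotti–Tate group pulled back» and the P6b Serre–Tate side (O-δ).  HC_CM is proved only modulo the printed
citations until rung 0 closes; nothing here is about HC.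

THE TWO LEGS.  For an idempotent `ε` of a Barsotti–Tate group `B → S` and `σ : S′ → S`, ★ `BTGroup.Hom.fixBTGroupBaseChangeIso`
(`BarsottiTateGroupFixedPartBaseChange` §3) is the isomorphism of Barsotti–Tate groups `(Fix ε) ×_S S′ ≅ Fix (ε ×_S S′)` — FIRST LEG, generic, ★.  For
`B := 𝒜[p^∞]` the right-hand side lives in `(𝒜[p^∞]) ×_S S′`, which is NOT `(𝒜 ×_S S′)[p^∞]` on the nose; ★ p846589
`exists_iso_baseChange_pDivisibleGroup` is the isomorphism `e : (𝒜[p^∞]) ×_S S′ ≅ (𝒜 ×_S S′)[p^∞]` of Barsotti–Tate groups intertwining the block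
idempotents `ε_a ×_S S′` and `ε_a′` (★ `baseChange_homOfCompatibleFamily_app_comp`).  The SECOND LEG (§1, generic, new) is «`Fix` IS FUNCTORIAL IN
ISOMORPHISMS OF BARSOTTI–TATE GROUPS INTERTWINING THE IDEMPOTENTS»: `Fix ε ≅ Fix ε′` by ★ `fixRestrict` both ways.  §2 composes the legs.

THE PRINT.  [Tate1967] §2 (2.1)–(2.2) (the category of `p`-divisible groups; `A ↦ A(p)` a functor compatible with base change); [Messing1972] Ch. I
(1.1)–(1.6) (Barsotti–Tate groups, their homomorphisms and kernels are stable under every base change); [RapoportSmithlingZhang2020Diagonal] §4.1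
(p. 17) «(dec pdiv)»: `A[p^∞] = ∏_{w ∣ p} A[w^∞]` with its `O_{F,w}`-actions, FUNCTORIALLY — in particular compatibly with base change, which is how
the `w`-block of the universal∕integral-model abelian scheme is read fibre by fibre; [GortzWedhorn2020] Definition 4.45 (2) (p. 117) (functoriality of
fixed subgroup schemes).  Nothing here is a new theorem of algebraic geometry: the file ASSEMBLES ★ `fixRestrict` (functoriality of `Fix`, with
`fixRestrict_comp ∕ _congr ∕ _id`), ★ `fixBTGroupBaseChangeIso` and ★ p846589.

WHAT IS HERE.
* §1 GENERIC (`e : Iso B B′`, idempotents `ε`, `ε′` with rank data, `he : ∀ n, e.hom.app n ≫ ε′.app n = ε.app n ≫ e.hom.app n`): `Iso.inv_app_comm`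
  (`e⁻¹` intertwines backwards), `fixRestrict_hom_comp_fixRestrict_inv ∕ fixRestrict_inv_comp_fixRestrict_hom` (the two restrictions are inverse),
  **`exists_fixBTGroup_iso_of_iso : ∃ E : Iso (Fix ε) (Fix ε′), E.hom = fixRestrict … e.hom he ∧ E.inv = fixRestrict … e.inv _`** (so `E.hom ≫ ι′ = ι ≫ e.hom`
  by ★ `fixRestrict_comp_fixBTGroupι`; the heights then agree over a non-empty base, ★ `Iso.height_eq`, not assumed), and
  **`fixRestrict_comp_fixRestrict_comm`** — restricted endomorphisms `res φ`, `res φ′` are intertwined by the restriction `res F` of any `F : B → B′`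
  intertwining `φ`, `φ′` (and the idempotents).
* §2 THE `w`-BLOCK OF `𝒜[p^∞]` (`𝒜` over `Spec R` with `act : RingAction O 𝒜`, block family `a`, ANY `σ : Spec R′ → Spec R`; `ε_a`, `ε_a′` the block
  idempotents of `𝒜[p^∞]`, `(𝒜 ×_R R′)[p^∞]`): **`exists_iso_blockBTGroup_baseChange`** — an isomorphism of Barsotti–Tate groups over `Spec R′`
  `E : (Fix ε_a) ×_R R′ ≅ Fix ε_a′` (the latter assembled with ★ p846589 `hrank_blockBTGroup_baseChange`) which (i) commutes with the inclusions all the way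
  into `𝒜 ×_R R′` (`E_n ≫ ι′_n ≫ ι_{(𝒜 ×_R R′)[pⁿ]} = (ι_n ≫ ι_{𝒜[pⁿ]}) ×_R R′`) and (ii) intertwines, for every `r : O`, the base change of the restricted
  action `res (ι r)[p^∞]` on `Fix ε_a` (the (O-LOC) action `βw⁰ r`, ★ `BTGroupBlock`) with the restricted action `res (ι_{R′} r)[p^∞]` on `Fix ε_a′`;
  `exists_iso_blockBTGroup_baseChange'` — the same for ANY rank datum `hrank′` on `Spec R′` (proof-irrelevant restatement for consumers holding their own).

## References
* [Tate1967] J. T. Tate, *p-divisible groups*, Proc. Conf. Local Fields (Driebergen, 1966), Springer (1967) — §2 (2.1)–(2.2).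
* [Messing1972] W. Messing, *The Crystals Associated to Barsotti–Tate Groups*, LNM 264 (1972) — Ch. I (1.1)–(1.6).
* [RapoportSmithlingZhang2020Diagonal] M. Rapoport, B. Smithling, W. Zhang, *Arithmetic diagonal cycles on unitary Shimura varieties*, Compos. Math. 156
  (2020) — §4.1 (p. 17), «(dec pdiv)».
* [GortzWedhorn2020] U. Görtz, T. Wedhorn, *Algebraic Geometry I*, 2nd ed. (2020) — Definition 4.45 (2) (p. 117), Section (4.7) (pp. 107–108).
-/

set_option autoImplicit false

noncomputable section

-- `(B.baseChange g).G n = (Over.pullback g).obj (B.G n)`, `(F.baseChange g).app n = (Over.pullback g).map (F.app n)`, `(pDivisibleGroup hp hg).G n =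
-- torsion (p ^ n)` are definitional only above `instances` transparency (as in ★ `BarsottiTateGroupFixedPartBaseChange{,Action}`).
set_option backward.isDefEq.respectTransparency false

universe u v

open CategoryTheory CategoryTheory.Limits AlgebraicGeometry MonoidalCategory CartesianMonoidalCategory
open scoped MonObj CategoryTheory.Obj

namespace Literature.AlgebraicGeometry.GroupSchemes

/-! ## §1 `Fix` is functorial in isomorphisms of Barsotti–Tate groups intertwining the idempotents -/

namespace BTGroup

/-- An isomorphism of Barsotti–Tate groups intertwining `ε` and `ε′` intertwines them backwards, layerwise: `e⁻¹_n ≫ ε_n = ε′_n ≫ e⁻¹_n`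
(★ `AbelianSchemes.inv_comp_eq_comp_inv_of_hom_comp` on the layer `e.app n`). [cite: Tate1967, §2 (2.1)] -/
theorem Iso.inv_app_comm {S : Scheme.{u}} {p h h' : ℕ} {B : BTGroup S p h} {B' : BTGroup S p h'} (e : Iso B B') (ε : Hom B B)
    (ε' : Hom B' B') (he : ∀ n, e.hom.app n ≫ ε'.app n = ε.app n ≫ e.hom.app n) (n : ℕ) :
    e.inv.app n ≫ ε.app n = ε'.app n ≫ e.inv.app n :=
  AbelianSchemes.inv_comp_eq_comp_inv_of_hom_comp (e.app n) (he n)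

namespace Hom

section IsoOfIso

variable {S : Scheme.{u}} {p h h' : ℕ} {B : BTGroup S p h} {B' : BTGroup S p h'} (e : Iso B B')
  (ε : Hom B B) (hε : ∀ n, ε.app n ≫ ε.app n = ε.app n) (h₁ : ℕ)
  (hrank : ∀ n (s : S), (ε.fixLayer n).hom.finrank s = p ^ (n * h₁))
  (ε' : Hom B' B') (hε' : ∀ n, ε'.app n ≫ ε'.app n = ε'.app n) (h₁' : ℕ)
  (hrank' : ∀ n (s : S), (ε'.fixLayer n).hom.finrank s = p ^ (n * h₁'))

/-- `res e ≫ res e⁻¹ = 𝟙` on `Fix ε` (★ `fixRestrict_comp`, `fixRestrict_congr`, `fixRestrict_id`). [cite: Tate1967, §2 (2.1)] [cite: GortzWedhorn2020, Definition 4.45 (2) (p. 117)] -/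
theorem fixRestrict_hom_comp_fixRestrict_inv (he : ∀ n, e.hom.app n ≫ ε'.app n = ε.app n ≫ e.hom.app n) :
    (fixRestrict ε hε h₁ hrank ε' hε' h₁' hrank' e.hom he).comp
        (fixRestrict ε' hε' h₁' hrank' ε hε h₁ hrank e.inv (Iso.inv_app_comm e ε ε' he)) = Hom.id _ := by
  rw [← fixRestrict_comp, ← fixRestrict_id ε hε h₁ hrank]
  exact fixRestrict_congr ε hε h₁ hrank ε hε h₁ hrank _ _ e.hom_inv_id

/-- `res e⁻¹ ≫ res e = 𝟙` on `Fix ε′`. [cite: Tate1967, §2 (2.1)] [cite: GortzWedhorn2020, Definition 4.45 (2) (p. 117)] -/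
theorem fixRestrict_inv_comp_fixRestrict_hom (he : ∀ n, e.hom.app n ≫ ε'.app n = ε.app n ≫ e.hom.app n) :
    (fixRestrict ε' hε' h₁' hrank' ε hε h₁ hrank e.inv (Iso.inv_app_comm e ε ε' he)).comp
        (fixRestrict ε hε h₁ hrank ε' hε' h₁' hrank' e.hom he) = Hom.id _ := by
  rw [← fixRestrict_comp, ← fixRestrict_id ε' hε' h₁' hrank']
  exact fixRestrict_congr ε' hε' h₁' hrank' ε' hε' h₁' hrank' _ _ e.inv_hom_id

/-- **`Fix` IS FUNCTORIAL IN ISOMORPHISMS OF BARSOTTI–TATE GROUPS INTERTWINING THE IDEMPOTENTS: `Fix ε ≅ Fix ε′`.**  For `e : B ≅ B′` with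
`e_n ≫ ε′_n = ε_n ≫ e_n` and idempotents `ε`, `ε′` assembled into Barsotti–Tate groups `Fix ε`, `Fix ε′` by any rank data (★ `fixBTGroup`), the restrictions
`res e : Fix ε → Fix ε′`, `res e⁻¹ : Fix ε′ → Fix ε` (★ `fixRestrict`) are inverse isomorphisms of Barsotti–Tate groups; by ★ `fixRestrict_comp_fixBTGroupι`,
`E.hom ≫ ι′ = ι ≫ e.hom`.  (Over a non-empty base the heights `h₁ = h₁′` then agree, ★ `Iso.height_eq`.) [cite: Tate1967, §2 (2.1)–(2.2)]
[cite: RapoportSmithlingZhang2020Diagonal, §4.1 (p. 17)] [cite: GortzWedhorn2020, Definition 4.45 (2) (p. 117)] -/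
theorem exists_fixBTGroup_iso_of_iso (he : ∀ n, e.hom.app n ≫ ε'.app n = ε.app n ≫ e.hom.app n) :
    ∃ E : Iso (ε.fixBTGroup hε h₁ hrank) (ε'.fixBTGroup hε' h₁' hrank'),
      E.hom = fixRestrict ε hε h₁ hrank ε' hε' h₁' hrank' e.hom he ∧
        E.inv = fixRestrict ε' hε' h₁' hrank' ε hε h₁ hrank e.inv (Iso.inv_app_comm e ε ε' he) :=
  ⟨⟨_, _, fixRestrict_hom_comp_fixRestrict_inv e ε hε h₁ hrank ε' hε' h₁' hrank' he,
    fixRestrict_inv_comp_fixRestrict_hom e ε hε h₁ hrank ε' hε' h₁' hrank' he⟩, rfl, rfl⟩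

/-- **Restricted intertwiners intertwine restricted endomorphisms.**  If `F : B → B′` intertwines the idempotents (`F_n ≫ ε′_n = ε_n ≫ F_n`) AND two
endomorphisms `φ` of `B`, `φ′` of `B′` commuting with them (`φ_n ≫ F_n = F_n ≫ φ′_n`), then `res φ ≫ res F = res F ≫ res φ′` on the fixed parts (both are
the restriction of `φ ≫ F = F ≫ φ′`, ★ `fixRestrict_comp ∕ _congr`).  The case `φ = β r`, `φ′ = β′ r` of two ring actions intertwined by `F` says that
`res F` is `O`-equivariant for the restricted actions. [cite: Tate1967, §2 (2.2)] [cite: RapoportSmithlingZhang2020Diagonal, §4.1 (p. 17)] -/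
theorem fixRestrict_comp_fixRestrict_comm (F : Hom B B') (hF : ∀ n, F.app n ≫ ε'.app n = ε.app n ≫ F.app n)
    (φ : Hom B B) (hφ : ∀ n, φ.app n ≫ ε.app n = ε.app n ≫ φ.app n)
    (φ' : Hom B' B') (hφ' : ∀ n, φ'.app n ≫ ε'.app n = ε'.app n ≫ φ'.app n)
    (hφF : ∀ n, φ.app n ≫ F.app n = F.app n ≫ φ'.app n) :
    (fixRestrict ε hε h₁ hrank ε hε h₁ hrank φ hφ).comp (fixRestrict ε hε h₁ hrank ε' hε' h₁' hrank' F hF) =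
      (fixRestrict ε hε h₁ hrank ε' hε' h₁' hrank' F hF).comp (fixRestrict ε' hε' h₁' hrank' ε' hε' h₁' hrank' φ' hφ') := by
  rw [← fixRestrict_comp, ← fixRestrict_comp]
  exact fixRestrict_congr ε hε h₁ hrank ε' hε' h₁' hrank' _ _ (Hom.ext hφF)

end IsoOfIso

end Hom

end BTGroup

end Literature.AlgebraicGeometry.GroupSchemes

namespace Literature.AlgebraicGeometry.AbelianSchemes

namespace AbelianSchemeOver

open Literature.AlgebraicGeometry.GroupSchemes Literature.AlgebraicGeometry.GroupSchemes.BTGroup.Hom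

/-! ## §2 The `w`-block of `𝒜[p^∞]` commutes with base change, inside `𝒜 ×_R R′`, `O`-equivariantly -/

section Block

variable {R R' : Type u} [CommRing R] [CommRing R'] (𝒜 : AbelianSchemeOver (Spec (.of R))) [IsCommMonObj 𝒜.X] {p g : ℕ}
  (hp : p ≠ 0) (hg : 𝒜.IsOfRelDim g) {O : Type v} [CommRing O] (act : RingAction O 𝒜) (a : ℕ → O)
  (ha : ∀ n, a (n + 1) - a n ∈ Ideal.span {(p : O) ^ n}) (σ : Spec (.of R') ⟶ Spec (.of R)) [IsCommMonObj (𝒜.baseChange σ).X]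
  (ha2 : ∀ n, a n * a n - a n ∈ Ideal.span {(p : O) ^ n}) {h : ℕ}
  (hrank : ∀ n (s : ↥(Spec (.of R))),
    (((act.isRingActionBT_pDivisibleGroupMap hp hg).homOfCompatibleFamily a ha).fixLayer n).hom.finrank s = p ^ (n * h))

/-- **THE `w`-BLOCK COMMUTES WITH BASE CHANGE, for any rank datum on `Spec R′`.**  `𝒜 → Spec R` an abelian scheme (commutative group law) with
`act : RingAction O 𝒜`, `a : ℕ → O` a `p`-adically compatible, `p`-adically idempotent family (the block family of `e_w`), `ε_a` ∕ `ε_a′` the idempotents it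
defines on `𝒜[p^∞]` ∕ `(𝒜 ×_R R′)[p^∞]` (★ `homOfCompatibleFamily` for ★ `isRingActionBT_pDivisibleGroupMap`), `σ : Spec R′ → Spec R` ANY ring map, and rank
data `hrank` ∕ `hrank′` of height `h` for the two fixed parts.  Then there is an isomorphism of Barsotti–Tate groups over `Spec R′`
`E : (Fix ε_a) ×_R R′ ≅ Fix ε_a′` (★ `fixBTGroupBaseChangeIso` ▸ §1 along ★ p846589 `exists_iso_baseChange_pDivisibleGroup`) such that (i) for every `n`,
`E_n ≫ ι′_n ≫ ι_{(𝒜 ×_R R′)[pⁿ]} = (ι_n ≫ ι_{𝒜[pⁿ]}) ×_R R′` — `E` is THE identification of `(𝒜[w^∞]) ×_R R′` with `(𝒜 ×_R R′)[w^∞]` inside `𝒜 ×_R R′` —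
and (ii) for every `r : O`, `(res (ι r)[p^∞]) ×_R R′ ≫ E = E ≫ res (ι_{R′} r)[p^∞]` — `E` is `O`-equivariant for the restricted actions `βw⁰` of ★ `BTGroupBlock`
(so also for their localisations `R_w → End`, which are determined by `βw⁰`). [cite: RapoportSmithlingZhang2020Diagonal, §4.1 (p. 17)]
[cite: Messing1972, Ch. I (1.1)–(1.6)] [cite: Tate1967, §2 (2.1)–(2.2)] -/
theorem exists_iso_blockBTGroup_baseChange'
    (hrank' : ∀ n (s' : ↥(Spec (.of R'))),
      ((((act.baseChange σ).isRingActionBT_pDivisibleGroupMap hp (hg.baseChange σ)).homOfCompatibleFamily a ha).fixLayer n).hom.finrank s' =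
        p ^ (n * h)) :
    ∃ E : BTGroup.Iso
        ((((act.isRingActionBT_pDivisibleGroupMap hp hg).homOfCompatibleFamily a ha).fixBTGroup
          ((act.isRingActionBT_pDivisibleGroupMap hp hg).homOfCompatibleFamily_idem a ha ha2) h hrank).baseChange σ)
        ((((act.baseChange σ).isRingActionBT_pDivisibleGroupMap hp (hg.baseChange σ)).homOfCompatibleFamily a ha).fixBTGroup
          (((act.baseChange σ).isRingActionBT_pDivisibleGroupMap hp (hg.baseChange σ)).homOfCompatibleFamily_idem a ha ha2) h hrank'),
      (∀ n, E.hom.app n ≫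
          (((act.baseChange σ).isRingActionBT_pDivisibleGroupMap hp (hg.baseChange σ)).homOfCompatibleFamily a ha).fixLayerι n ≫
            (𝒜.baseChange σ).torsionι (p ^ n) =
        (Over.pullback σ).map
          (((act.isRingActionBT_pDivisibleGroupMap hp hg).homOfCompatibleFamily a ha).fixLayerι n ≫ 𝒜.torsionι (p ^ n))) ∧
      ∀ r : O,
        ((fixRestrict _ ((act.isRingActionBT_pDivisibleGroupMap hp hg).homOfCompatibleFamily_idem a ha ha2) h hrank
              _ ((act.isRingActionBT_pDivisibleGroupMap hp hg).homOfCompatibleFamily_idem a ha ha2) h hrank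
              (haveI := act.isMonHom_i r; pDivisibleGroupMap (act.i r) hp hg hg)
              ((act.isRingActionBT_pDivisibleGroupMap hp hg).app_comp_homOfCompatibleFamily_app a ha r)).baseChange σ).comp E.hom =
          E.hom.comp
            (fixRestrict _ (((act.baseChange σ).isRingActionBT_pDivisibleGroupMap hp (hg.baseChange σ)).homOfCompatibleFamily_idem a ha ha2)
              h hrank'
              _ (((act.baseChange σ).isRingActionBT_pDivisibleGroupMap hp (hg.baseChange σ)).homOfCompatibleFamily_idem a ha ha2) h hrank'
              (haveI := (act.baseChange σ).isMonHom_i r; pDivisibleGroupMap ((act.baseChange σ).i r) hp (hg.baseChange σ) (hg.baseChange σ))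
              (((act.baseChange σ).isRingActionBT_pDivisibleGroupMap hp (hg.baseChange σ)).app_comp_homOfCompatibleFamily_app a ha r)) := by
  obtain ⟨e, he⟩ := 𝒜.exists_iso_baseChange_pDivisibleGroup hp hg σ
  have hcomm : ∀ n, e.hom.app n ≫ (((act.baseChange σ).isRingActionBT_pDivisibleGroupMap hp (hg.baseChange σ)).homOfCompatibleFamily a ha).app n =
      (((act.isRingActionBT_pDivisibleGroupMap hp hg).homOfCompatibleFamily a ha).baseChange σ).app n ≫ e.hom.app n :=
    fun n => (𝒜.baseChange_homOfCompatibleFamily_app_comp hp hg σ act a ha e.hom he n).symm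
  -- the second leg, along `e`
  obtain ⟨E₂, hE₂, -⟩ := exists_fixBTGroup_iso_of_iso e _
    (baseChange_idem σ _ ((act.isRingActionBT_pDivisibleGroupMap hp hg).homOfCompatibleFamily_idem a ha ha2)) h
    (hrank_baseChange σ _ ((act.isRingActionBT_pDivisibleGroupMap hp hg).homOfCompatibleFamily_idem a ha ha2) h hrank)
    _ (((act.baseChange σ).isRingActionBT_pDivisibleGroupMap hp (hg.baseChange σ)).homOfCompatibleFamily_idem a ha ha2) h hrank' hcomm
  refine ⟨(fixBTGroupBaseChangeIso σ _ ((act.isRingActionBT_pDivisibleGroupMap hp hg).homOfCompatibleFamily_idem a ha ha2) h hrank).trans E₂,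
    fun n => ?_, fun r => ?_⟩
  · -- (i) compatibility with the inclusions into `𝒜 ×_R R′`
    have h1 := fixBTGroupBaseChangeIso_hom_app_comp_fixLayerι σ _
      ((act.isRingActionBT_pDivisibleGroupMap hp hg).homOfCompatibleFamily_idem a ha ha2) h hrank n
    have h2 := fixRestrict_app_comp_fixLayerι _
      (baseChange_idem σ _ ((act.isRingActionBT_pDivisibleGroupMap hp hg).homOfCompatibleFamily_idem a ha ha2)) h
      (hrank_baseChange σ _ ((act.isRingActionBT_pDivisibleGroupMap hp hg).homOfCompatibleFamily_idem a ha ha2) h hrank)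
      _ (((act.baseChange σ).isRingActionBT_pDivisibleGroupMap hp (hg.baseChange σ)).homOfCompatibleFamily_idem a ha ha2) h hrank'
      e.hom hcomm n
    rw [← hE₂] at h2
    simp only [BTGroup.Iso.trans, comp_app, Category.assoc]
    rw [reassoc_of% h2, reassoc_of% h1, he n, ← Functor.map_comp]
  · -- (ii) `O`-equivariance: first leg ★ `baseChange_fixRestrict_comp_iso`, second leg §1 `fixRestrict_comp_fixRestrict_comm`
    have hφF : ∀ n, ((haveI := act.isMonHom_i r; pDivisibleGroupMap (act.i r) hp hg hg).baseChange σ).app n ≫ e.hom.app n =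
        e.hom.app n ≫ (haveI := (act.baseChange σ).isMonHom_i r;
          pDivisibleGroupMap ((act.baseChange σ).i r) hp (hg.baseChange σ) (hg.baseChange σ)).app n :=
      fun n => 𝒜.baseChange_ringAction_app_comp hp hg σ act e.hom he r n
    have h1 := baseChange_fixRestrict_comp_iso σ _ ((act.isRingActionBT_pDivisibleGroupMap hp hg).homOfCompatibleFamily_idem a ha ha2) h hrank
      _ ((act.isRingActionBT_pDivisibleGroupMap hp hg).homOfCompatibleFamily_idem a ha ha2) h hrank
      (haveI := act.isMonHom_i r; pDivisibleGroupMap (act.i r) hp hg hg)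
      ((act.isRingActionBT_pDivisibleGroupMap hp hg).app_comp_homOfCompatibleFamily_app a ha r)
    have h2 := fixRestrict_comp_fixRestrict_comm _
      (baseChange_idem σ _ ((act.isRingActionBT_pDivisibleGroupMap hp hg).homOfCompatibleFamily_idem a ha ha2)) h
      (hrank_baseChange σ _ ((act.isRingActionBT_pDivisibleGroupMap hp hg).homOfCompatibleFamily_idem a ha ha2) h hrank)
      _ (((act.baseChange σ).isRingActionBT_pDivisibleGroupMap hp (hg.baseChange σ)).homOfCompatibleFamily_idem a ha ha2) h hrank'
      e.hom hcomm _
      (baseChange_comm σ _ _ _ ((act.isRingActionBT_pDivisibleGroupMap hp hg).app_comp_homOfCompatibleFamily_app a ha r))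
      _ (((act.baseChange σ).isRingActionBT_pDivisibleGroupMap hp (hg.baseChange σ)).app_comp_homOfCompatibleFamily_app a ha r) hφF
    rw [← hE₂] at h2
    simp only [BTGroup.Iso.trans]
    rw [← comp_assoc, h1, comp_assoc, h2, ← comp_assoc]

/-- **THE `w`-BLOCK COMMUTES WITH BASE CHANGE** — `exists_iso_blockBTGroup_baseChange'` with the rank datum on `Spec R′` SUPPLIED by ★ p846589
`hrank_blockBTGroup_baseChange` (so the only rank input is `hrank` on `Spec R`). [cite: RapoportSmithlingZhang2020Diagonal, §4.1 (p. 17)]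
[cite: Messing1972, Ch. I (1.1)–(1.6)] [cite: Tate1967, §2 (2.1)–(2.2)] -/
theorem exists_iso_blockBTGroup_baseChange :
    ∃ E : BTGroup.Iso
        ((((act.isRingActionBT_pDivisibleGroupMap hp hg).homOfCompatibleFamily a ha).fixBTGroup
          ((act.isRingActionBT_pDivisibleGroupMap hp hg).homOfCompatibleFamily_idem a ha ha2) h hrank).baseChange σ)
        ((((act.baseChange σ).isRingActionBT_pDivisibleGroupMap hp (hg.baseChange σ)).homOfCompatibleFamily a ha).fixBTGroup
          (((act.baseChange σ).isRingActionBT_pDivisibleGroupMap hp (hg.baseChange σ)).homOfCompatibleFamily_idem a ha ha2) h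
          (𝒜.hrank_blockBTGroup_baseChange hp hg act a ha σ ha2 hrank)),
      (∀ n, E.hom.app n ≫
          (((act.baseChange σ).isRingActionBT_pDivisibleGroupMap hp (hg.baseChange σ)).homOfCompatibleFamily a ha).fixLayerι n ≫
            (𝒜.baseChange σ).torsionι (p ^ n) =
        (Over.pullback σ).map
          (((act.isRingActionBT_pDivisibleGroupMap hp hg).homOfCompatibleFamily a ha).fixLayerι n ≫ 𝒜.torsionι (p ^ n))) ∧
      ∀ r : O,
        ((fixRestrict _ ((act.isRingActionBT_pDivisibleGroupMap hp hg).homOfCompatibleFamily_idem a ha ha2) h hrank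
              _ ((act.isRingActionBT_pDivisibleGroupMap hp hg).homOfCompatibleFamily_idem a ha ha2) h hrank
              (haveI := act.isMonHom_i r; pDivisibleGroupMap (act.i r) hp hg hg)
              ((act.isRingActionBT_pDivisibleGroupMap hp hg).app_comp_homOfCompatibleFamily_app a ha r)).baseChange σ).comp E.hom =
          E.hom.comp
            (fixRestrict _ (((act.baseChange σ).isRingActionBT_pDivisibleGroupMap hp (hg.baseChange σ)).homOfCompatibleFamily_idem a ha ha2)
              h (𝒜.hrank_blockBTGroup_baseChange hp hg act a ha σ ha2 hrank)
              _ (((act.baseChange σ).isRingActionBT_pDivisibleGroupMap hp (hg.baseChange σ)).homOfCompatibleFamily_idem a ha ha2) h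
              (𝒜.hrank_blockBTGroup_baseChange hp hg act a ha σ ha2 hrank)
              (haveI := (act.baseChange σ).isMonHom_i r; pDivisibleGroupMap ((act.baseChange σ).i r) hp (hg.baseChange σ) (hg.baseChange σ))
              (((act.baseChange σ).isRingActionBT_pDivisibleGroupMap hp (hg.baseChange σ)).app_comp_homOfCompatibleFamily_app a ha r)) :=
  𝒜.exists_iso_blockBTGroup_baseChange' hp hg act a ha σ ha2 hrank (𝒜.hrank_blockBTGroup_baseChange hp hg act a ha σ ha2 hrank)

end Block

end AbelianSchemeOver

end Literature.AlgebraicGeometry.AbelianSchemes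

end
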